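import Literature.Computability.AlgebraicComplexity.RealTauConjectureDepthFour
import HarnessLib

/-!
# Binary numerals and powers in the constant-free model, over any ring
# (Bürgisser 2009, §2.2 "`τ(k) ≤ 2 log k`"; Chatterjee–Tengse 2023, proof of Lemma 3.5: "`α` can
# be computed by a constant-free circuit of size `O(log α)`"; square-and-multiply)

Theorem-only additions (no definitions, no named facts) to the constant-free circuit calculus of
`ConstantFreeCircuits.lean` (the `τ`-calculus over `ℤ`: `constantFreeComplexity_add_le`, …,
`constantFreeComplexity_C_two_pow_le`, `constantFreeComplexity_aeval_le`) and to the base change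
`ArithCircuit.map` of `RealTauConjectureDepthFour.lean` (`eval_map_apply`, `size_map`,
`IsFanInTwo.map`). They serve constructions that must hard-wire a LARGE natural number, or a
large power of a computed value, into a fan-in-two circuit WITH SIGN CONSTANTS (`0, ±1` only) in
`O(log)` gates over an arbitrary commutative ring — e.g. the Kronecker constants
`α^{Δ^b}`, `α^{2^ℓ Δ^b}` (`α ∈ ℕ`) of the encoder of Chatterjee–Tengse's Lemma 3.5 on the
constant-free Lemma 4.7 path (val-lit t20 g9; support brick for the X-CT23 `HasSignConstants`
twin R4 of `CT23ExplicitAnnihilatorCircuit.lean`). Honest framing: elementary circuit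
bookkeeping; nothing here bears on `VP ≠ VNP`, which is NOT proved.

## Contents

* §1 `τ`-calculus over `ℤ` (square-and-multiply): `constantFreeComplexity_X_pow_le_log`
  (`τ(X^e) ≤ 2(log₂ e + 1)`), `constantFreeComplexity_pow_le_log`
  (`τ(f^e) ≤ τ(f) + 2(log₂ e + 1)`, the base computed ONCE, by `constantFreeComplexity_aeval_le`).
* §2 RING-GENERIC binary numerals: `ArithCircuit.exists_signConst_natCast` — over any
  commutative semiring `k`, `C (n : k)` has a fan-in-two circuit with sign constants of size
  `≤ 3 · log₂ n` (Horner on the binary digits, `n = 2⌊n/2⌋ + (n mod 2)`, `2 = 1 + 1`).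
* §3 Base change of sign constants: `ArithCircuit.HasSignConstants.map` (a ring homomorphism
  maps `{0, 1, -1}` into `{0, 1, -1}`), `ArithCircuit.exists_signConst_map_int` (a `τ`-minimal
  integer circuit, base-changed along `ℤ → k`, is a circuit with sign constants computing
  `map (Int.castRingHom k) f` of size `τ(f)`), `constantFreeComplexity_map_int_le`, and the
  ring-generic substitution bound `ArithCircuit.exists_signConst_aeval_int` (twin of
  `constantFreeComplexity_aeval_le`: plug circuits over `k` into a `τ`-minimal integer template).
* §4 RING-GENERIC powers: `ArithCircuit.exists_signConst_pow` (`f^e` from a circuit for `f`, `+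
  2(log₂ e + 1)` gates), `ArithCircuit.exists_signConst_natCast_pow` (`C ((n : k)^e)` in
  `≤ 3 log₂ n + 2(log₂ e + 1)` gates); over `ℤ`: `constantFreeComplexity_C_natCast_pow_le_log`,
  `constantFreeComplexity_C_intCast_le_log`.

The `τ`-form `τ(C n) ≤ 3(log₂ n + 1)` over `ℤ` is `constantFreeComplexity_C_natCast_le_log` of
`Literature/Barriers/ValiantsHypothesis/CT23ProjCircuitBaseChange.lean` (val-lit t18 g8); it is
not restated here (§2 is the circuit-level, ring-generic statement).

## References
* [Burgisser2009] P. Bürgisser, *On defining integers and proving arithmetic circuit lower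
  bounds*, Comput. Complexity 18 (2009), §2.2 ("`τ(k) ≤ 2 log k`"; the constant-free model).
* [Burgisser2000] P. Bürgisser, *Completeness and Reduction in Algebraic Complexity Theory*,
  §1.4 (the `τ` measure), Rem. 2.7 (substitution), §4.1 (extension of scalars).
* [ChatterjeeTengse2023] P. Chatterjee, A. Tengse, *Lower Bounds from Succinct Hitting Sets*,
  arXiv:2309.07612v2, proof of Lemma 3.5 (v1: Lemma 42; held text p0015.txt:L70–L73).
-/

noncomputable section

open MvPolynomial

namespace Literature.Computability.AlgebraicComplexity

universe u v w

/-! ### §1 Square-and-multiply in the `τ`-calculus over `ℤ` -/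

section TauPow

variable {σ : Type v}

/-- **Square-and-multiply on a free variable: `τ(X^e) ≤ 2·(log₂ e + 1)`** (`X^(2q+b) = (X^q)² · X^b`:
one squaring, at most one product with the free variable). [cite: Burgisser2009, §2.2] -/
theorem constantFreeComplexity_X_pow_le_log (i : σ) (e : ℕ) :
    constantFreeComplexity (X i ^ e : MvPolynomial σ ℤ) ≤ 2 * (Nat.log 2 e + 1) := by
  induction e using Nat.strong_induction_on with
  | _ e ih =>
    rcases Nat.lt_or_ge e 2 with he | he
    · obtain rfl | rfl : e = 0 ∨ e = 1 := by omega
      · simp [constantFreeComplexity_one]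
      · simp
    · set q := e / 2 with hq
      have hqe : q < e := by omega
      have hlog : Nat.log 2 q + 1 = Nat.log 2 e := by
        rw [hq, Nat.log_div_base, Nat.sub_add_cancel]
        exact Nat.succ_le_of_lt (Nat.log_pos one_lt_two he)
      have hsq : constantFreeComplexity ((X i ^ q) ^ 2 : MvPolynomial σ ℤ) ≤
          2 * (Nat.log 2 q + 1) + 1 :=
        (constantFreeComplexity_sq_le _).trans (Nat.add_le_add_right (ih q hqe) 1)
      rcases Nat.mod_two_eq_zero_or_one e with h0 | h1
      · have hdecomp : (X i ^ e : MvPolynomial σ ℤ) = (X i ^ q) ^ 2 := by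
          rw [← pow_mul]; congr 1; omega
        rw [hdecomp]
        calc constantFreeComplexity ((X i ^ q) ^ 2 : MvPolynomial σ ℤ)
            ≤ 2 * (Nat.log 2 q + 1) + 1 := hsq
          _ ≤ 2 * (Nat.log 2 e + 1) := by rw [← hlog]; omega
      · have hdecomp : (X i ^ e : MvPolynomial σ ℤ) = (X i ^ q) ^ 2 * X i := by
          rw [← pow_mul, ← pow_succ]; congr 1; omega
        rw [hdecomp]
        calc constantFreeComplexity ((X i ^ q) ^ 2 * X i : MvPolynomial σ ℤ)
            ≤ constantFreeComplexity ((X i ^ q) ^ 2 : MvPolynomial σ ℤ) +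
                constantFreeComplexity (X i : MvPolynomial σ ℤ) + 1 :=
              constantFreeComplexity_mul_le _ _
          _ ≤ (2 * (Nat.log 2 q + 1) + 1) + 0 + 1 := by
              rw [constantFreeComplexity_X]; exact Nat.add_le_add_right (Nat.add_le_add_right hsq _) _
          _ = 2 * (Nat.log 2 e + 1) := by rw [← hlog]; ring

/-- **Powers: `τ(f^e) ≤ τ(f) + 2·(log₂ e + 1)`** — compute `f` once and substitute it for the free
variable of `X^e` (`constantFreeComplexity_aeval_le`). [cite: Burgisser2009, §2.2] -/
theorem constantFreeComplexity_pow_le_log (f : MvPolynomial σ ℤ) (e : ℕ) :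
    constantFreeComplexity (f ^ e) ≤ constantFreeComplexity f + 2 * (Nat.log 2 e + 1) := by
  have h := constantFreeComplexity_aeval_le (σ := Fin 1) (X 0 ^ e : MvPolynomial (Fin 1) ℤ)
    (fun _ => f)
  simp only [map_pow, aeval_X, Finset.univ_unique, Fin.default_eq_zero, Finset.sum_singleton] at h
  calc constantFreeComplexity (f ^ e)
      ≤ constantFreeComplexity (X 0 ^ e : MvPolynomial (Fin 1) ℤ) + constantFreeComplexity f := h
    _ ≤ 2 * (Nat.log 2 e + 1) + constantFreeComplexity f :=
        Nat.add_le_add_right (constantFreeComplexity_X_pow_le_log _ _) _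
    _ = constantFreeComplexity f + 2 * (Nat.log 2 e + 1) := Nat.add_comm _ _

end TauPow

namespace ArithCircuit

/-! ### §2 Binary numerals with sign constants over any commutative semiring -/

section Numerals

variable {k : Type u} [CommSemiring k] {σ : Type v}

/-- **Binary numerals, ring-generic.** Over any commutative semiring, the constant `C n` (`n ∈ ℕ`)
is computed by a fan-in-two circuit whose only constants are `0, 1`, of size `≤ 3 · log₂ n`:
Horner on the binary digits, `C n = C ⌊n/2⌋ · (1 + 1) + C (n mod 2)` (one sum for `2 = 1 + 1`,
one product, one sum per digit). This is the circuit behind "`α` can be computed by a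
constant-free circuit of size `O(log α)`".
[cite: Burgisser2009, §2.2; ChatterjeeTengse2023, proof of Lemma 3.5 (v1: Lemma 42; p0015.txt:L70–L73)] -/
theorem exists_signConst_natCast (n : ℕ) :
    ∃ P : ArithCircuit k σ, P.IsFanInTwo ∧ P.HasSignConstants ∧ P.Computes (C (n : k)) ∧
      P.size ≤ 3 * Nat.log 2 n := by
  induction n using Nat.strong_induction_on with
  | _ n ih =>
    rcases Nat.lt_or_ge n 2 with hn | hn
    · refine ⟨ofConst (n : k), IsFanInTwo.ofConst _, (hasSignConstants_ofConst_iff _).2 ?_, rfl,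
        by simp⟩
      obtain rfl | rfl : n = 0 ∨ n = 1 := by omega
      · exact Or.inl Nat.cast_zero
      · exact Or.inr (Or.inl Nat.cast_one)
    · obtain ⟨Q, hQ1, hQ2, hQ3, hQ4⟩ := ih (n / 2) (by omega)
      have hlog : Nat.log 2 (n / 2) + 1 = Nat.log 2 n := by
        rw [Nat.log_div_base, Nat.sub_add_cancel]
        exact Nat.succ_le_of_lt (Nat.log_pos one_lt_two hn)
      have h1 : (ofConst 1 : ArithCircuit k σ).HasSignConstants :=
        (hasSignConstants_ofConst_iff _).2 isSignConstant_one
      have hb : (ofConst ((n % 2 : ℕ) : k) : ArithCircuit k σ).HasSignConstants := by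
        refine (hasSignConstants_ofConst_iff _).2 ?_
        rcases Nat.mod_two_eq_zero_or_one n with h | h
        · exact Or.inl (by rw [h, Nat.cast_zero])
        · exact Or.inr (Or.inl (by rw [h, Nat.cast_one]))
      refine ⟨(Q.mul ((ofConst 1).add (ofConst 1))).add (ofConst ((n % 2 : ℕ) : k)),
        (hQ1.mul ((IsFanInTwo.ofConst _).add (IsFanInTwo.ofConst _))).add (IsFanInTwo.ofConst _),
        (hQ2.mul (h1.add h1)).add hb, ?_, ?_⟩
      · rw [Computes] at hQ3 ⊢
        rw [add_eval, mul_eval, add_eval, hQ3, eval_ofConst, eval_ofConst, ← C_add, ← C_mul,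
          ← C_add]
        congr 1
        have hn2 : n = n / 2 * 2 + n % 2 := (Nat.div_add_mod' n 2).symm
        conv_rhs => rw [hn2]
        push_cast
        ring
      · rw [size_add, size_mul, size_add, size_ofConst, size_ofConst]
        omega

end Numerals

/-! ### §3 Base change of sign constants; integer templates over any ring -/

section BaseChange

variable {k : Type u} {k' : Type w} [CommSemiring k] [CommSemiring k'] {σ : Type v}

/-- **A change of coefficients along a ring homomorphism preserves sign constants** (`φ` maps
`0 ↦ 0`, `1 ↦ 1`, and `c + 1 = 0 ⇒ φ c + 1 = 0`). [cite: Burgisser2000, §4.1, §1.4] -/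
theorem HasSignConstants.map {P : ArithCircuit k σ} (hP : P.HasSignConstants) (φ : k →+* k') :
    (P.map φ).HasSignConstants := by
  have hc : ∀ {c : k}, IsSignConstant c → IsSignConstant (φ c) := by
    rintro c (rfl | rfl | h)
    · exact Or.inl (map_zero φ)
    · exact Or.inr (Or.inl (map_one φ))
    · exact Or.inr (Or.inr (by rw [← map_one φ, ← map_add, h, map_zero]))
  have hu : ∀ {u : Operand k σ}, u.HasSignConstants → (u.map φ).HasSignConstants := by
    intro u h
    cases u with
    | var i => trivial
    | const c => exact hc h
    | gate j => trivial
  refine ⟨fun g hg => ?_, hu hP.2⟩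
  simp only [ArithCircuit.map, List.mem_map] at hg
  obtain ⟨g', hg', rfl⟩ := hg
  have h' := hP.1 g' hg'
  cases g' with
  | sum args =>
    intro a ha
    simp only [List.mem_map] at ha
    obtain ⟨a', ha', rfl⟩ := ha
    exact ⟨hc (h' a' ha').1, hu (h' a' ha').2⟩
  | prod args =>
    intro u hu'
    simp only [List.mem_map] at hu'
    obtain ⟨u', hu'', rfl⟩ := hu'
    exact hu (h' u' hu'')

end BaseChange

section IntTemplates

variable {k : Type u} [CommRing k] {σ : Type v} {ι : Type w}

/-- **Integer circuits over any ring.** A `τ`-minimal constant-free integer circuit for `f`,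
base-changed along `ℤ → k`, is a fan-in-two circuit with sign constants of size `τ(f)` computing
the image of `f`. [cite: Burgisser2000, §4.1, §1.4] -/
theorem exists_signConst_map_int (f : MvPolynomial σ ℤ) :
    ∃ P : ArithCircuit k σ, P.IsFanInTwo ∧ P.HasSignConstants ∧
      P.Computes (MvPolynomial.map (Int.castRingHom k) f) ∧ P.size = constantFreeComplexity f := by
  obtain ⟨P, h1, h2, h3, h4⟩ := exists_computes_size_eq_constantFreeComplexity f
  exact ⟨P.map (Int.castRingHom k), h1.map _, h2.map _, h3.map _, by rw [size_map, h4]⟩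

/-- **Ring-generic substitution bound** (twin of `constantFreeComplexity_aeval_le`): plugging
fan-in-two circuits with sign constants `Q i` (computing `g i` over `k`) into the inputs of a
`τ`-minimal integer template `F` gives a fan-in-two circuit with sign constants computing
`F(g)` of size `≤ τ(F) + ∑ |Q i|`. [cite: Burgisser2000, Rem. 2.7, §4.1] -/
theorem exists_signConst_aeval_int [Fintype ι] (F : MvPolynomial ι ℤ) {Q : ι → ArithCircuit k σ}
    {g : ι → MvPolynomial σ k} (h2 : ∀ i, (Q i).IsFanInTwo) (hs : ∀ i, (Q i).HasSignConstants)
    (hg : ∀ i, (Q i).Computes (g i)) :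
    ∃ P : ArithCircuit k σ, P.IsFanInTwo ∧ P.HasSignConstants ∧
      P.Computes (aeval g (MvPolynomial.map (Int.castRingHom k) F)) ∧
      P.size ≤ constantFreeComplexity F + ∑ i, (Q i).size := by
  classical
  obtain ⟨P, hP1, hP2, hP3, hP4⟩ := exists_signConst_map_int (k := k) F
  -- enumerate the variables and juxtapose the `Q i`
  set m := Fintype.card ι
  set e : ι ≃ Fin m := Fintype.equivFin ι
  set L : List (ArithCircuit k σ) := List.ofFn fun j : Fin m => Q (e.symm j) with hL
  have hLlen : L.length = m := by simp [hL]
  have hmemL : ∀ R ∈ L, ∃ i, R = Q i := fun R hR => by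
    simp only [hL, List.mem_ofFn] at hR
    obtain ⟨j, rfl⟩ := hR
    exact ⟨_, rfl⟩
  set ρ : ι → Operand k σ := fun i => (juxtOuts L)[(e i : ℕ)]'(by simp [hLlen]) with hρ
  have hρeval : ∀ i ws, (ρ i).eval (gateValues (juxtGates L) ++ ws) = g i := fun i ws => by
    have hi : ((e i : ℕ)) < L.length := by simp [hLlen]
    have h := eval_juxtOuts L (e i) hi ws
    simp only [hρ]
    rw [h]
    have : L[(e i : ℕ)]'hi = Q i := by simp [hL, List.getElem_ofFn]
    rw [this]
    exact hg i
  refine ⟨P.substCircuit (juxtGates L) ρ,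
    hP1.substCircuit (fanIn_juxtGates fun R hR => by
      obtain ⟨i, rfl⟩ := hmemL R hR; exact h2 i) ρ,
    hP2.substCircuit (hasSignConstants_juxtGates fun R hR => by
      obtain ⟨i, rfl⟩ := hmemL R hR; exact hs i) fun i =>
        hasSignConstants_juxtOuts (fun R hR => by obtain ⟨i, rfl⟩ := hmemL R hR; exact hs i) _
          (List.getElem_mem _), ?_, ?_⟩
  · rw [Computes] at hP3 ⊢
    rw [eval_substCircuit P (juxtGates L) hρeval, hP3]
  · rw [size_substCircuit, length_juxtGates, hP4, add_comm]
    refine le_of_eq ?_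
    congr 1
    rw [hL, List.map_ofFn, List.sum_ofFn]
    exact Fintype.sum_equiv e.symm _ _ fun j => rfl

/-! ### §4 Powers with sign constants over any ring -/

/-- **Square-and-multiply, ring-generic.** From a fan-in-two circuit with sign constants for `f`,
one for `f^e` with `2(log₂ e + 1)` more gates (the `τ`-minimal integer circuit for `X^e`,
base-changed, with the given circuit substituted for `X`). [cite: Burgisser2009, §2.2; Burgisser2000, Rem. 2.7] -/
theorem exists_signConst_pow {P : ArithCircuit k σ} {f : MvPolynomial σ k} (h2 : P.IsFanInTwo)
    (hs : P.HasSignConstants) (hf : P.Computes f) (e : ℕ) :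
    ∃ P' : ArithCircuit k σ, P'.IsFanInTwo ∧ P'.HasSignConstants ∧ P'.Computes (f ^ e) ∧
      P'.size ≤ P.size + 2 * (Nat.log 2 e + 1) := by
  obtain ⟨P', h1, h2', h3, h4⟩ := exists_signConst_aeval_int (k := k) (σ := σ)
    (X () ^ e : MvPolynomial Unit ℤ) (Q := fun _ => P) (g := fun _ => f) (fun _ => h2)
    (fun _ => hs) (fun _ => hf)
  refine ⟨P', h1, h2', ?_, ?_⟩
  · rw [Computes] at h3 ⊢
    rw [h3, map_pow, map_X, map_pow, aeval_X]
  · calc P'.size ≤ constantFreeComplexity (X () ^ e : MvPolynomial Unit ℤ) + ∑ _i : Unit, P.size := h4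
      _ ≤ 2 * (Nat.log 2 e + 1) + P.size := by
          rw [Fintype.sum_unique]
          exact Nat.add_le_add_right (constantFreeComplexity_X_pow_le_log _ _) _
      _ = P.size + 2 * (Nat.log 2 e + 1) := Nat.add_comm _ _

/-- **Powers of numerals, ring-generic**: `C ((n : k)^e)` has a fan-in-two circuit with sign
constants of size `≤ 3 log₂ n + 2(log₂ e + 1)` (the Kronecker-type constants `α^E`, `α ∈ ℕ`,
of a constant-free encoder). [cite: Burgisser2009, §2.2; ChatterjeeTengse2023, proof of Lemma 3.5 (v1: Lemma 42; p0015.txt:L70–L73)] -/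
theorem exists_signConst_natCast_pow (n e : ℕ) :
    ∃ P : ArithCircuit k σ, P.IsFanInTwo ∧ P.HasSignConstants ∧ P.Computes (C ((n : k) ^ e)) ∧
      P.size ≤ 3 * Nat.log 2 n + 2 * (Nat.log 2 e + 1) := by
  obtain ⟨P, h1, h2, h3, h4⟩ := exists_signConst_natCast (k := k) (σ := σ) n
  obtain ⟨P', h1', h2', h3', h4'⟩ := exists_signConst_pow h1 h2 h3 e
  exact ⟨P', h1', h2', by rw [C_pow]; exact h3', h4'.trans (by omega)⟩

end IntTemplates

end ArithCircuit

/-! ### `τ`-corollaries over `ℤ` -/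

section TauNumerals

open ArithCircuit

variable {σ : Type v}

/-- `τ` of an image polynomial is at most `τ` of the integer polynomial. [cite: Burgisser2000, §4.1, §1.4] -/
theorem constantFreeComplexity_map_int_le {k : Type u} [CommRing k] (f : MvPolynomial σ ℤ) :
    constantFreeComplexity (MvPolynomial.map (Int.castRingHom k) f) ≤ constantFreeComplexity f := by
  obtain ⟨P, h1, h2, h3, h4⟩ := exists_signConst_map_int (k := k) f
  exact h4 ▸ constantFreeComplexity_le_size h1 h2 h3

/-- `τ(C n) ≤ 3 log₂ n` over `ℤ`, read off the ring-generic numeral circuit (the `+1`-weaker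
`τ`-form is `constantFreeComplexity_C_natCast_le_log` of `CT23ProjCircuitBaseChange.lean`). [cite: Burgisser2009, §2.2] -/
private theorem tau_C_natCast_le (n : ℕ) :
    constantFreeComplexity (C (n : ℤ) : MvPolynomial σ ℤ) ≤ 3 * Nat.log 2 n := by
  obtain ⟨P, h1, h2, h3, h4⟩ := exists_signConst_natCast (k := ℤ) (σ := σ) n
  exact (constantFreeComplexity_le_size h1 h2 h3).trans h4

/-- **Powers of numerals over `ℤ`: `τ(C (n^e)) ≤ 3 log₂ n + 2(log₂ e + 1)`.** [cite: Burgisser2009, §2.2] -/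
theorem constantFreeComplexity_C_natCast_pow_le_log (n e : ℕ) :
    constantFreeComplexity (C ((n : ℤ) ^ e) : MvPolynomial σ ℤ) ≤
      3 * Nat.log 2 n + 2 * (Nat.log 2 e + 1) := by
  rw [C_pow]
  exact (constantFreeComplexity_pow_le_log _ _).trans
    (Nat.add_le_add_right (tau_C_natCast_le n) _)

/-- **Integers: `τ(C a) ≤ 3 log₂ |a| + 1`** (a numeral, negated if `a < 0`). [cite: Burgisser2009, §2.2] -/
theorem constantFreeComplexity_C_intCast_le_log (a : ℤ) :
    constantFreeComplexity (C a : MvPolynomial σ ℤ) ≤ 3 * Nat.log 2 a.natAbs + 1 := by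
  rcases le_or_gt 0 a with ha | ha
  · have : (C a : MvPolynomial σ ℤ) = C ((a.natAbs : ℕ) : ℤ) := by
      rw [Int.natAbs_of_nonneg ha]
    rw [this]
    exact (tau_C_natCast_le _).trans (Nat.le_succ _)
  · have : (C a : MvPolynomial σ ℤ) = -C ((a.natAbs : ℕ) : ℤ) := by
      rw [← map_neg C]; congr 1; omega
    rw [this]
    exact (constantFreeComplexity_neg_le _).trans (Nat.add_le_add_right (tau_C_natCast_le _) 1)

end TauNumerals

end Literature.Computability.AlgebraicComplexity
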